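import Literature.AnabelianGeometry.EtaleTheta.Discharge.Sec1OrbitGenerator
import Literature.AnabelianGeometry.EtaleTheta.SettingModelMuTwo
import HarnessLib

/-!
# [EtTh] Def. 1.7 / 1.9: the orbit-generator clause (B2) «`Π^tp_Ẋ/Π^tp_Ÿ ≅ ℤ`» is INDEPENDENT of the
# typed interface `MuTwoSetting` — the converse of abc-iut-L2-t6's `exists_orbit_generator`, and a
# kernel model on each side (holder of the K2 sub-DAG, abc-iut-w5-d140)

S. Mochizuki, *The étale theta function …*, Publ. RIMS 45 (2009), §1, Def. 1.7 (p.253: «`ε_μ ∈ Gal(Ẍ/X)`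
… the unique nontrivial element … that acts trivially on the set of irreducible components of the special
fiber», «a nontrivial element `ε_Z ∈ Gal(Ẍ/X)` which is `≠ ε_μ`»), Def. 1.9 (p.255: «the
`Π^tp_Ẋ/Π^tp_Ÿ ≅ ℤ`-orbit») [cite: MochizukiEtTh2009, Def 1.7 p.27].  PROOF-ONLY companion (no `def`) of
`ConstantMultipleRigidity.lean` (abc-iut-L2-t1), `Discharge/Sec1OrbitGenerator.lean` (p419021,
abc-iut-L2-t6: parity ⇒ (B2)) and `SettingModelMuTwo.lean` (p421643, abc-iut-L2-t1: the kernel model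
`MuTwoSetting.model p`).  GAP-LEDGER row G-L2t6g4-3 / clause P-C8 of `MuTwoSetting.IsDef17Origin`.

PROVED:
* `odd_toZ_of_orbitGenerator` — the CONVERSE of `exists_orbit_generator`: for admissible `ε_Z`, if some
  `σ₁` generates `inclX⁻¹(Π^tp_Ẋ)` modulo `Π^tp_Ÿ`, then every lift of `ε_Z` has ODD `toZ`; so over the
  interface **(B2) ⟺ `toZ(ε_Z)` odd**;
* `SettingModel.toZ_epsMu_lift_model` / `model_exists_orbitGenerator` — at abc-iut-L2-t1's model
  (`ε_μ := b`, of `toZ`-degree `0`) clause P-C8 HOLDS and (B2) holds for EVERY admissible `ε_Z`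
  (non-vacuity of the hypotheses of the K2 junction p420097 on the (B2) side);
* `SettingModel.exists_admissible_not_orbitGenerator` — at the SAME model with the roles of the two
  generators exchanged (`ε_μ := a`; still a `MuTwoSetting p` over the same root `ThetaSetting.model p`,
  hence with `IsEtThOrigin`), `ε_Z := b` is admissible and of EVEN degree, so (B2) FAILS:
  **`∃ (M : MuTwoSetting p) (εZ), M.IsAdmissibleEpsZ εZ ∧ M.toThetaSetting.IsEtThOrigin ∧ ¬(B2)`**.
Hence (B2), equivalently the `ε_μ`-parity clause P-C8, is NOT decided by the interface `MuTwoSetting`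
(nor by admissibility or `IsEtThOrigin`): it must be carried as the printed sentence it is
(`MuTwoSetting.IsDef17Origin.epsMu_mem_sup`, abc-iut-L2-t6 p421622) — exactly as abc-iut-L2-d1 g4 argued
at the quotient `Π^tp_X/Π^tp_Ÿ ≅ ℤ × ℤ/2` (03:01Z).  HONEST FRAMING: a statement about OUR interface
and a toy model (consistency evidence, not the π₁ of a curve); nothing here bears on [IUTchIII] Cor. 3.12.
-/

noncomputable section

namespace Literature.AnabelianGeometry.EtaleTheta

open Literature.AnabelianGeometry.SemiGraphs

namespace MuTwoSetting

variable {p : ℕ} [Fact p.Prime] {M : MuTwoSetting p}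

/-- **(B2) forces the parity of `ε_Z`** (converse of `exists_orbit_generator`), for admissible `ε_Z`: if
`σ₁` generates `inclX⁻¹(Π^tp_Ẋ)` modulo `Π^tp_Ÿ` then every lift `e` of `ε_Z` has odd `toZ` — otherwise
`e·(t·t)^{−m} ∈ inclX⁻¹(Π^tp_Ẋ) ∩ Π^tp_Y` would lie in `Π^tp_Ÿ ⊆ Π^tp_Ẍ` (degree count through `σ₁`,
whose degree is nonzero because `t·t ∈ Π^tp_Ẍ` has degree `2`), contradicting `ε_Z ∉ Π^tp_Ẍ`.
[cite: MochizukiEtTh2009, Def 1.9 p.29] -/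
theorem odd_toZ_of_orbitGenerator {εZ : M.GtpC} (hZ : M.IsAdmissibleEpsZ εZ) {e : M.PiTemp}
    (he : M.inclX e = εZ) {σ₁ : M.PiTemp}
    (hgen : ∀ σ : M.PiTemp, M.inclX σ ∈ M.dotX εZ →
      ∃ (a : ℤ) (h : M.PiTemp), h ∈ M.toThetaSetting.GtpYdd ∧ σ = σ₁ ^ a * h) :
    Odd (Multiplicative.toAdd (M.toZ e)) := by
  obtain ⟨t, ht⟩ := M.exists_toZ_eq_one
  rcases Int.even_or_odd (Multiplicative.toAdd (M.toZ e)) with ⟨m, hm⟩ | hodd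
  · exfalso
    haveI := M.GtpXdd_normal
    -- `t·t ∈ Π^tp_Ẍ` has degree `2`, so `toZ σ₁ ≠ 0`
    obtain ⟨b, h', hh', hb⟩ := hgen (t * t) (by
      rw [inclX_mem_dotX_iff he]; exact Or.inl (M.mul_self_mem_GtpXdd t))
    have hZ₁ : Multiplicative.toAdd (M.toZ σ₁) ≠ 0 := by
      intro h0
      have := congrArg (fun x => Multiplicative.toAdd (M.toZ x)) hb
      have h'Z : M.toZ h' = 1 := M.GtpYdd_le_GtpY hh'
      simp only [map_mul, map_zpow, toAdd_mul, toAdd_zpow, h0, smul_eq_mul, mul_zero, zero_add,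
        h'Z, toAdd_one, ht] at this
      omega
    -- `g := e (tt)^{-m}` has degree `0` and lies in `inclX⁻¹(Π^tp_Ẋ)`
    set g : M.PiTemp := e * (t * t) ^ (-m) with hgdef
    have hgZ : Multiplicative.toAdd (M.toZ g) = 0 := by
      rw [hgdef]
      simp only [map_mul, map_zpow, toAdd_mul, toAdd_zpow, smul_eq_mul, ht, hm]; ring
    have hgX : M.inclX g ∈ M.dotX εZ := by
      rw [inclX_mem_dotX_iff he, hgdef]
      exact Or.inr ((inferInstance : M.GtpXdd.Normal).conj_mem _
        (M.GtpXdd.zpow_mem (M.mul_self_mem_GtpXdd t) (-m)) e)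
    obtain ⟨a, h, hh, hga⟩ := hgen g hgX
    have haZ : a * Multiplicative.toAdd (M.toZ σ₁) = 0 := by
      have := congrArg (fun x => Multiplicative.toAdd (M.toZ x)) hga
      simp only [map_mul, map_zpow, toAdd_mul, toAdd_zpow, smul_eq_mul] at this
      have hhZ : M.toZ h = 1 := M.GtpYdd_le_GtpY hh
      rw [hhZ, toAdd_one, add_zero, hgZ] at this
      exact this.symm
    have ha : a = 0 := (mul_eq_zero.1 haZ).resolve_right hZ₁
    rw [ha, zpow_zero, one_mul] at hga
    -- so `g ∈ Π^tp_Ÿ ⊆ Π^tp_Ẍ`, hence `e ∈ Π^tp_Ẍ`: contradiction with admissibility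
    have heX : e ∈ M.GtpXdd := by
      have : e = g * (t * t) ^ m := by
        rw [hgdef, mul_assoc, ← zpow_add, neg_add_cancel, zpow_zero, mul_one]
      rw [this]
      exact M.GtpXdd.mul_mem (hga ▸ M.GtpYdd_le_GtpXdd hh)
        (M.GtpXdd.zpow_mem (M.mul_self_mem_GtpXdd t) m)
    exact hZ.2.1 (he ▸ Subgroup.mem_map_of_mem M.inclX heX)
  · exact hodd

/-- Hence, for admissible `ε_Z` with a lift of EVEN degree, (B2) FAILS. [cite: MochizukiEtTh2009, Def 1.9 p.29] -/
theorem not_orbitGenerator_of_even {εZ : M.GtpC} (hZ : M.IsAdmissibleEpsZ εZ) {e : M.PiTemp}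
    (he : M.inclX e = εZ) (heven : Even (Multiplicative.toAdd (M.toZ e))) :
    ¬ ∃ σ₁ : M.PiTemp, M.inclX σ₁ ∈ M.dotX εZ ∧ ∀ σ : M.PiTemp, M.inclX σ ∈ M.dotX εZ →
      ∃ (a : ℤ) (h : M.PiTemp), h ∈ M.toThetaSetting.GtpYdd ∧ σ = σ₁ ^ a * h := by
  rintro ⟨σ₁, -, hgen⟩
  exact (Int.not_odd_iff_even.mpr heven) (odd_toZ_of_orbitGenerator hZ he hgen)

end MuTwoSetting

/-! ### The two models: P-C8 holds at `MuTwoSetting.model p`, fails after exchanging the generators -/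

namespace SettingModel

variable (p : ℕ) [Fact p.Prime]

/-- In abc-iut-L2-t1's model the distinguished lift `(b, 1)` of `ε_μ` has `toZ`-degree `0`
(`toZ` = the `a`-exponent sum). [cite: MochizukiEtTh2009, Def 1.7 p.27] -/
theorem toZ_epsMu_lift_model :
    Multiplicative.toAdd ((MuTwoSetting.model p).toZ (Del.ofF₂ (FreeGroup.of 1), 1)) = 0 := by
  show Multiplicative.toAdd (toZM p (Del.ofF₂ (FreeGroup.of 1), 1)) = 0
  rw [toZM_apply]
  simp [Del.val_ofF₂]

/-- **P-C8 / (B2) HOLD at the model**: for every admissible `ε_Z` of `MuTwoSetting.model p` the orbit group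
`inclX⁻¹(Π^tp_Ẋ)/Π^tp_Ÿ` is generated by one element (abc-iut-L2-t6's `exists_orbit_generator` fed with
the even degree of `ε_μ`'s lift) — non-vacuity of the (B2)-hypotheses of the K2 junction.
[cite: MochizukiEtTh2009, Def 1.9 p.29] -/
theorem model_exists_orbitGenerator {εZ : (MuTwoSetting.model p).GtpC}
    (hZ : (MuTwoSetting.model p).IsAdmissibleEpsZ εZ) :
    ∃ σ₁ : (MuTwoSetting.model p).PiTemp, (MuTwoSetting.model p).inclX σ₁ ∈ (MuTwoSetting.model p).dotX εZ ∧
      ∀ σ, (MuTwoSetting.model p).inclX σ ∈ (MuTwoSetting.model p).dotX εZ →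
        ∃ (a : ℤ) (h : (MuTwoSetting.model p).PiTemp),
          h ∈ (MuTwoSetting.model p).toThetaSetting.GtpYdd ∧ σ = σ₁ ^ a * h := by
  obtain ⟨e, he⟩ := hZ.1
  have hodd := (MuTwoSetting.model p).odd_toZ_of_isAdmissibleEpsZ hZ he
    (μ := (Del.ofF₂ (FreeGroup.of 1), 1)) rfl (by rw [toZ_epsMu_lift_model]; exact ⟨0, rfl⟩)
  obtain ⟨σ₁, h1, -, h3⟩ := MuTwoSetting.exists_orbit_generator he hodd
  exact ⟨σ₁, h1, h3⟩

/-- `b · a⁻¹ ∉ Δ_Ẍ` (odd `a`-exponent). [cite: MochizukiEtTh2009, Def 1.7 p.27] -/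
theorem of_one_mul_of_zero_inv_not_mem_deltaXdd :
    FreeGroup.of (1 : Fin 2) * (FreeGroup.of 0)⁻¹ ∉ deltaXdd := by
  intro h
  have h' : heisHom (FreeGroup.of (1 : Fin 2) * (FreeGroup.of 0)⁻¹) ∈ heisMod 2 := h
  rw [mem_heisMod_iff, map_mul, map_inv, heisHom_of_one, heisHom_of_zero] at h'
  obtain ⟨h1, -⟩ := h'
  simp at h1

/-- **(B2) / P-C8 is NOT decided by the interface**: exchanging the roles of the two generators in
abc-iut-L2-t1's model (`ε_μ :=` the lift of `a`, of `toZ`-degree `1`) gives another `MuTwoSetting p` over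
the SAME root (`IsEtThOrigin` holds) in which `ε_Z := b` is admissible with a lift of EVEN degree `0`, so
the orbit group is not generated by one element modulo `Π^tp_Ÿ`. Together with
`model_exists_orbitGenerator`: (B2) is independent of `MuTwoSetting + IsAdmissibleEpsZ + IsEtThOrigin`,
and must be supplied by the printed `ε_μ`-clause (`MuTwoSetting.IsDef17Origin.epsMu_mem_sup`).
[cite: MochizukiEtTh2009, Def 1.7 p.27] -/
theorem exists_admissible_not_orbitGenerator :
    ∃ (M : MuTwoSetting p) (εZ : M.GtpC), M.IsAdmissibleEpsZ εZ ∧ M.toThetaSetting.IsEtThOrigin ∧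
      ¬ ∃ σ₁ : M.PiTemp, M.inclX σ₁ ∈ M.dotX εZ ∧ ∀ σ : M.PiTemp, M.inclX σ ∈ M.dotX εZ →
        ∃ (a : ℤ) (h : M.PiTemp), h ∈ M.toThetaSetting.GtpYdd ∧ σ = σ₁ ^ a * h := by
  -- the model with `ε_μ := (a, 1)` instead of `(b, 1)`
  let M' : MuTwoSetting p :=
    { MuTwoSetting.model p with
      epsMu := inclXM p (Del.ofF₂ (FreeGroup.of 0), 1)
      epsMu_mem := ⟨_, rfl⟩
      epsMu_not_mem := by
        intro h
        rw [Subgroup.mem_map_iff_mem (MuTwoSetting.model p).injective_inclX] at h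
        exact of_zero_not_mem_deltaXdd h.1 }
  have hinj : Function.Injective M'.inclX := (MuTwoSetting.model p).injective_inclX
  refine ⟨M', inclXM p (Del.ofF₂ (FreeGroup.of 1), 1), ⟨⟨_, rfl⟩, ?_, ?_⟩,
    ThetaSetting.model_isEtThOrigin p, ?_⟩
  · -- `b ∉ Π^tp_Ẍ`
    show inclXM p (Del.ofF₂ (FreeGroup.of 1), 1) ∉ (Xdd p).map (inclXM p)
    intro h
    rw [Subgroup.mem_map_iff_mem hinj] at h
    exact of_one_not_mem_deltaXdd h.1
  · -- `b · a⁻¹ ∉ Π^tp_Ẍ`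
    show inclXM p (Del.ofF₂ (FreeGroup.of 1), 1) * (inclXM p (Del.ofF₂ (FreeGroup.of 0), 1))⁻¹ ∉
      (Xdd p).map (inclXM p)
    rw [← map_inv, ← map_mul]
    intro h
    rw [Subgroup.mem_map_iff_mem hinj] at h
    exact of_one_mul_of_zero_inv_not_mem_deltaXdd h.1
  · -- the lift `(b, 1)` of `ε_Z` has degree `0`, even
    exact MuTwoSetting.not_orbitGenerator_of_even (M := M') ⟨⟨_, rfl⟩, by
        show inclXM p (Del.ofF₂ (FreeGroup.of 1), 1) ∉ (Xdd p).map (inclXM p)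
        intro h
        rw [Subgroup.mem_map_iff_mem hinj] at h
        exact of_one_not_mem_deltaXdd h.1, by
        show inclXM p (Del.ofF₂ (FreeGroup.of 1), 1) * (inclXM p (Del.ofF₂ (FreeGroup.of 0), 1))⁻¹ ∉
          (Xdd p).map (inclXM p)
        rw [← map_inv, ← map_mul]
        intro h
        rw [Subgroup.mem_map_iff_mem hinj] at h
        exact of_one_mul_of_zero_inv_not_mem_deltaXdd h.1⟩
      (e := (Del.ofF₂ (FreeGroup.of 1), 1)) rfl (by
        have : Multiplicative.toAdd (M'.toZ (Del.ofF₂ (FreeGroup.of 1), 1)) = 0 :=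
          toZ_epsMu_lift_model p
        rw [this]; exact ⟨0, rfl⟩)

end SettingModel

end Literature.AnabelianGeometry.EtaleTheta

end
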